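import Literature.NumberTheory.Automorphic.SpreadLevelGroup

/-!
# Support and value of a spread bi-`ψ`-equivariant Whittaker function on a corner of `GL_N`

Summit `Langlands`, sub-problem `Langlands`, helper file under `Theorems/` supporting the crux
`PairLBoundaryJS` (stmt-Langlands-13622, Arthur–Clozel (1989), Ch. 3, (2.2)), line `Sketch`,
sub-goal `exists_unipotent_mul_level_of_ne_zero`: the VALUE form of the tree's Whittaker support
theorem `Literature.NumberTheory.Automorphic.WhittakerSupport.exists_eq_unipotent_mul_integral_of_mem_cornerGL`
(`WhittakerBiEquivariantSupport`), finite-place half of the "spread vector + thin test function"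
device (Jacquet–Piatetski-Shapiro–Shalika (1983), (2.7): at a thin place the local Rankin–Selberg
integral of a spread vector "can be made constant").

Setting: `F` a discretely valued field, `W : GL_N(F) → ℂ` with `IsSpreadWhittaker ψ t M W` (left
`ψ_N`-equivariant, right `ψ_N`-isotypic under the spread integral unipotents, right invariant under
the spread level group `Λ = d_t K(𝔭^M) d_t⁻¹`, `d_t = diag(t)`), `ψ` non-trivial on
`{|x| ≤ exp(1 - c₀)}`, `M ≥ 1`, `|t_j| ≤ |t_i|` (`i ≤ j`), gaps `exp(M - c₀)|t_{i+1}| ≤ |t_i|`.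

* `exists_unipotent_mul_level_of_ne_zero`: the tree theorem — `g` in the corner `GL_d ≤ GL_N`,
  `d < N`, `W(g) ≠ 0` ⟹ `g = u k`, `u ∈ N_N(F)`, `k ∈ GL_N(𝒪)` — with the SHARPER conclusion
  `d_t⁻¹ k d_t ∈ K(𝔭^M)` as well (`k ∈ Λ ∩ GL_N(𝒪)`). What changed: nothing in the mathematics; the
  tree's induction verbatim (its row matrix `k = 1 + e_{d-1} ⊗ (g_{d-1,·} - δ)` is proved there to
  satisfy the two `d_t`-twisted congruence inequalities `hklevel`, `hklevel'`), carrying the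
  membership `d_t⁻¹ k d_t ∈ K(𝔭^M)` (closed under products) through the induction.
* `apply_eq_whittakerCharFun_mul_apply_one_of_mem_cornerGL` (**main**, the value): moreover
  `W(g) = ψ_N(u) W(1)`, the level membership of `k` spelled as the two inequality families
  `|(k^{±1} - 1)_{ij} t_j| ≤ exp(-M)|t_i|` of `IsSpreadWhittaker.level` — on the corner `W` is
  `ψ_N ⊗ 𝟙` on `N_N(F) · (Λ ∩ GL_N(𝒪))` and zero elsewhere. (`conj_mem_valuedCongruenceSubgroup_of_level`,
  `level_of_conj_mem_valuedCongruenceSubgroup` translate between the membership and the inequalities.)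

Purely local algebra over a valued field; no measure, no adele. All proofs complete, no named fact.

## References

* H. Jacquet, I. I. Piatetski-Shapiro, J. A. Shalika, *Rankin–Selberg convolutions*, Amer. J. Math.
  105 (1983), §2, (2.7) [JacquetPiatetskiShapiroShalika1983].
* I. N. Bernstein, A. V. Zelevinsky, *Representations of the group GL(n, F) where F is a local
  non-archimedean field*, Russian Math. Surveys 31:3 (1976), §5 [BernsteinZelevinsky1976].
-/

noncomputable section

-- `Summit.Langlands.Langlands.…` (summit = sub-problem name, D-0017 layout) trips `dupNamespace`
set_option linter.dupNamespace false

open scoped MatrixGroups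
open Matrix WithZero
open Literature.NumberTheory.Automorphic Literature.NumberTheory.Automorphic.WhittakerSupport

namespace Summit.Langlands.Langlands.Theorems.WhittakerSupportValue

variable {F : Type*} [Field F] [Valued F ℤᵐ⁰] {N : ℕ}

local notation "𝓋" => (Valued.v : Valuation F ℤᵐ⁰)

omit [Valued F ℤᵐ⁰] in
/-- The matrix of `(diag(t)⁻¹ κ diag(t))⁻¹` is `diag(t)⁻¹ κ⁻¹ diag(t)` (`diagConj t⁻¹ κ⁻¹`). [folklore] -/
theorem coe_glDiagonal_inv_conj_inv (t : Fin N → Fˣ) (κ : GL (Fin N) F) :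
    ((((glDiagonal N F t)⁻¹ * κ * glDiagonal N F t)⁻¹ : GL (Fin N) F) : Matrix (Fin N) (Fin N) F) =
      diagConj t⁻¹ ((κ⁻¹ : GL (Fin N) F) : Matrix (Fin N) (Fin N) F) := by
  rw [show ((glDiagonal N F t)⁻¹ * κ * glDiagonal N F t)⁻¹ =
    (glDiagonal N F t)⁻¹ * κ⁻¹ * glDiagonal N F t by group]
  exact coe_glDiagonal_inv_conj t κ⁻¹

/-- **From the `d_t`-twisted congruence inequalities to `d_t⁻¹ κ d_t ∈ K(𝔭^M)`** (`M ≥ 0`): if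
`|(κ - 1)_{ij} t_j| ≤ exp(-M) |t_i|` and likewise for `κ⁻¹` (the `level` family of
`IsSpreadWhittaker`), then `diag(t)⁻¹ κ diag(t)` lies in the valued congruence subgroup of radius
`exp(-M)` (the computation inside the tree's `mem_spreadLevelGroup_of_level`). [folklore] -/
theorem conj_mem_valuedCongruenceSubgroup_of_level {t : Fin N → Fˣ} {M : ℤ} (hM : 0 ≤ M)
    {κ : GL (Fin N) F}
    (hκ : ∀ i j, 𝓋 (((κ : Matrix (Fin N) (Fin N) F) - 1) i j * t j) ≤ exp (-M) * 𝓋 (t i : F))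
    (hκ' : ∀ i j, 𝓋 ((((κ⁻¹ : GL (Fin N) F) : Matrix (Fin N) (Fin N) F) - 1) i j * t j) ≤
      exp (-M) * 𝓋 (t i : F)) :
    (glDiagonal N F t)⁻¹ * κ * glDiagonal N F t ∈ valuedCongruenceSubgroup (Fin N) (exp (-M)) := by
  have hexp : exp (-M) ≤ (1 : ℤᵐ⁰) := by rw [← exp_zero, exp_le_exp]; omega
  have hint : ∀ X : Matrix (Fin N) (Fin N) F, (∀ i j, 𝓋 ((X - 1) i j) ≤ exp (-M)) →
      ∀ i j, 𝓋 (X i j) ≤ 1 := by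
    intro X hX i j
    have h : X i j = (X - 1) i j + (1 : Matrix (Fin N) (Fin N) F) i j := by
      rw [Matrix.sub_apply, sub_add_cancel]
    rw [h]
    refine Valuation.map_add_le _ ((hX i j).trans hexp) ?_
    rw [Matrix.one_apply]
    split_ifs <;> simp
  have h1 := valuation_diagConj_inv_sub_one_le hκ
  have h2 := valuation_diagConj_inv_sub_one_le hκ'
  refine ⟨fun i j => ?_, fun i j => ?_, fun i j => ?_⟩
  · rw [coe_glDiagonal_inv_conj]; exact hint _ h1 i j
  · rw [coe_glDiagonal_inv_conj_inv]; exact hint _ h2 i j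
  · rw [coe_glDiagonal_inv_conj]; exact h1 i j

/-- **From `d_t⁻¹ κ d_t ∈ K(𝔭^M)` back to the `d_t`-twisted congruence inequalities**: the two
families `|(κ^{±1} - 1)_{ij} t_j| ≤ exp(-M) |t_i|` consumed by `IsSpreadWhittaker.level`
(since `(κ - 1)_{ij} t_j = t_i (d_t⁻¹ κ d_t - 1)_{ij}`). [folklore] -/
theorem level_of_conj_mem_valuedCongruenceSubgroup {t : Fin N → Fˣ} {M : ℤ} {κ : GL (Fin N) F}
    (h : (glDiagonal N F t)⁻¹ * κ * glDiagonal N F t ∈ valuedCongruenceSubgroup (Fin N) (exp (-M))) :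
    (∀ i j, 𝓋 (((κ : Matrix (Fin N) (Fin N) F) - 1) i j * t j) ≤ exp (-M) * 𝓋 (t i : F)) ∧
    (∀ i j, 𝓋 ((((κ⁻¹ : GL (Fin N) F) : Matrix (Fin N) (Fin N) F) - 1) i j * t j) ≤
      exp (-M) * 𝓋 (t i : F)) := by
  have key : ∀ (X : Matrix (Fin N) (Fin N) F) (i j : Fin N),
      (X - 1) i j * t j = (t i : F) * (diagConj t⁻¹ X - 1) i j := by
    intro X i j
    have e : diagConj t⁻¹ X - 1 = diagConj t⁻¹ (X - 1) := by rw [diagConj_sub, diagConj_one]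
    rw [e, diagConj_inv_apply, ← mul_assoc, ← mul_assoc, mul_inv_cancel₀ (t i).ne_zero, one_mul]
  refine ⟨fun i j => ?_, fun i j => ?_⟩
  · rw [key, Valuation.map_mul, mul_comm]
    refine mul_le_mul_left ?_ _
    have h3 := h.2.2 i j
    rwa [coe_glDiagonal_inv_conj] at h3
  · rw [key, Valuation.map_mul, mul_comm]
    refine mul_le_mul_left ?_ _
    have h3 := (inv_mem h).2.2 i j
    rwa [coe_glDiagonal_inv_conj_inv] at h3

/-- **Support theorem with the level** (sub-goal of the line `Sketch` of the crux `PairLBoundaryJS`).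
Under `IsSpreadWhittaker ψ t M W`, with `ψ` non-trivial somewhere on `{|x| ≤ exp(1 - c₀)}`, `M ≥ 1`,
`|t_j| ≤ |t_i|` for `i ≤ j` and gaps `exp(M - c₀) |t_{i+1}| ≤ |t_i|`: if `g` lies in the corner
`GL_d ≤ GL_N` with `d < N` and `W(g) ≠ 0`, then `g = u k` with `u ∈ N_N(F)`, `k ∈ GL_N(𝒪)` and
`diag(t)⁻¹ k diag(t) ∈ K(𝔭^M)`, i.e. `k ∈ GL_N(𝒪) ∩ diag(t) K(𝔭^M) diag(t)⁻¹`. The tree's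
`WhittakerSupport.exists_eq_unipotent_mul_integral_of_mem_cornerGL` verbatim (transvection
consistency `ψ(c (g_{d-1,i} - δ)) = 1`, valuation bound on the row `d - 1`, row matrix
`k = 1 + e_{d-1} ⊗ (g_{d-1,·} - δ)`, splitting off the corner, induction on `d`), additionally
recording that each row matrix lies in the spread level group (its `hklevel`, `hklevel'`).
(Jacquet–Piatetski-Shapiro–Shalika (1983), (2.7); Bernstein–Zelevinsky (1976), §5 — neither is
used.) [folklore] -/
theorem exists_unipotent_mul_level_of_ne_zero :
    ∀ (ψ : AddChar F Circle) {c₀ M : ℤ}, (∃ x : F, Valued.v x ≤ exp (1 - c₀) ∧ ψ x ≠ 1) → 1 ≤ M →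
      ∀ {t : Fin N → Fˣ}, (∀ i j : Fin N, i ≤ j → Valued.v (t j : F) ≤ Valued.v (t i : F)) →
      (∀ i j : Fin N, (i : ℕ) + 1 = j → exp (M - c₀) * Valued.v (t j : F) ≤ Valued.v (t i : F)) →
      ∀ {W : GL (Fin N) F → ℂ}, IsSpreadWhittaker ψ t M W →
      ∀ {d : ℕ}, d < N → ∀ {g : GL (Fin N) F}, g ∈ cornerGL N F d → W g ≠ 0 →
        ∃ u ∈ upperUnitriangular (Fin N) F, ∃ k ∈ valuedCongruenceSubgroup (Fin N) (1 : ℤᵐ⁰),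
          (glDiagonal N F t)⁻¹ * k * glDiagonal N F t ∈ valuedCongruenceSubgroup (Fin N) (exp (-M)) ∧
          g = u * k := by
  intro ψ c₀ M hψ hM₁ t hmono hgap W hW
  have ht0 : ∀ i, 𝓋 (t i : F) ≠ 0 := fun i => (Valuation.ne_zero_iff _).2 (t i).ne_zero
  have hexpM : exp (-M) ≤ (1 : ℤᵐ⁰) := by rw [← exp_zero, exp_le_exp]; omega
  have hexpM1 : exp (-M) < (1 : ℤᵐ⁰) := by rw [← exp_zero, exp_lt_exp]; omega
  intro d
  induction d with
  | zero =>
    intro _ g hg _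
    refine ⟨1, one_mem _, 1, one_mem _, ?_, ?_⟩
    · rw [mul_one, inv_mul_cancel]
      exact one_mem _
    rw [one_mul]
    refine Units.ext (Matrix.ext fun i j => ?_)
    rw [hg i j (Or.inl (Nat.zero_le _)), Units.val_one, Matrix.one_apply]
  | succ d ih =>
    intro hd g hg hne
    -- the row index `d` and the column index `d + 1`
    set iD : Fin N := ⟨d, by omega⟩ with hiD
    set jD : Fin N := ⟨d + 1, hd⟩ with hjD
    have hij : (iD : ℕ) + 1 = jD := rfl
    have hgE : ∀ l m : Fin N, (d + 1 ≤ (l : ℕ) ∨ d + 1 ≤ (m : ℕ)) →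
        (g : Matrix (Fin N) (Fin N) F) l m = if l = m then 1 else 0 := hg
    -- the deviation of the row `d` of `g` from the unit row
    set D : Fin N → F := fun m => (g : Matrix (Fin N) (Fin N) F) iD m - if iD = m then 1 else 0 with hD
    have hD0 : ∀ m : Fin N, ¬ (m : ℕ) ≤ d → D m = 0 := by
      intro m hm
      simp only [hD]
      rw [hgE iD m (Or.inr (by omega)), sub_self]
    -- Step 1: consistency of the left and right equivariances on the column group
    have hcons : ∀ i : Fin N, (i : ℕ) ≤ d → ∀ c : F, 𝓋 c * 𝓋 (t jD : F) ≤ 𝓋 (t i : F) →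
        ψ (D i * c) = 1 := by
      intro i hi c hc
      have hijD : (i : ℕ) < jD := by change (i : ℕ) < d + 1; omega
      have hbT : ∀ l : Fin N, jD ≤ l → (Pi.single i c : Fin N → F) l = 0 := by
        intro l hl
        rw [Pi.single_apply, if_neg]
        intro h
        rw [h] at hl
        exact absurd (Fin.lt_def.2 hijD) (not_lt.2 hl)
      set b' : Fin N → F := (g : Matrix (Fin N) (Fin N) F) *ᵥ Pi.single i c with hb'
      have hb'apply : ∀ l, b' l = (g : Matrix (Fin N) (Fin N) F) l i * c := fun l => by
        simp only [hb', mulVec, dotProduct_single]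
      have hb'0 : ∀ l : Fin N, jD ≤ l → b' l = 0 := by
        intro l hl
        have hl' : d + 1 ≤ (l : ℕ) := hl
        rw [hb'apply, hgE l i (Or.inl hl'), if_neg, zero_mul]
        intro h
        rw [h] at hl'
        omega
      -- `g T = T' g`
      have hprod : g * colGL (Pi.single i c) jD (hbT jD le_rfl) = colGL b' jD (hb'0 jD le_rfl) * g := by
        refine Units.ext ?_
        change (g : Matrix (Fin N) (Fin N) F) * (1 + vecMulVec (Pi.single i c) (Pi.single jD 1)) =
          (1 + vecMulVec b' (Pi.single jD 1)) * g
        rw [hb']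
        refine mul_one_add_vecMulVec_eq _ _ _ ?_
        rw [single_one_vecMul]
        funext m
        change (g : Matrix (Fin N) (Fin N) F) jD m = (Pi.single jD (1 : F) : Fin N → F) m
        rw [hgE jD m (Or.inl le_rfl), Pi.single_apply]
        by_cases h : jD = m
        · rw [if_pos h, if_pos h.symm]
        · rw [if_neg h, if_neg (Ne.symm h)]
      -- the valuation bounds for `T`
      have hTbd : ∀ l m : Fin N, 𝓋 (((colGL (Pi.single i c) jD (hbT jD le_rfl) : GL (Fin N) F) :
          Matrix (Fin N) (Fin N) F) l m * t m) ≤ 𝓋 (t l : F) := by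
        intro l m
        rw [colGL_apply, Pi.single_apply]
        by_cases hlm : l = m
        · subst hlm
          rw [if_pos rfl]
          by_cases hlj : l = jD
          · rw [if_pos hlj, if_neg, add_zero, one_mul]
            intro hli
            rw [hli] at hlj
            exact absurd hlj.symm (ne_of_lt (Fin.lt_def.2 hijD)).symm
          · rw [if_neg hlj, add_zero, one_mul]
        · rw [if_neg hlm, zero_add]
          by_cases hmj : m = jD
          · rw [if_pos hmj]
            by_cases hli : l = i
            · rw [if_pos hli, hmj, hli, Valuation.map_mul]
              exact hc
            · rw [if_neg hli, zero_mul, Valuation.map_zero]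
              exact zero_le
          · rw [if_neg hmj, zero_mul, Valuation.map_zero]
            exact zero_le
      have h1 := hW.right _ (colGL_mem_upperUnitriangular _ jD hbT) hTbd g
      have h2 := hW.left _ (colGL_mem_upperUnitriangular _ jD hb'0) g
      rw [hprod] at h1
      rw [h1] at h2
      have h3 := mul_right_cancel₀ hne h2
      rw [whittakerCharFun_colGL ψ _ jD hbT iD hij, whittakerCharFun_colGL ψ _ jD hb'0 iD hij,
        Circle.coe_inj, hb'apply, Pi.single_apply] at h3
      -- `h3 : ψ (if iD = i then c else 0) = ψ (g_{d i} c)`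
      have hDc : D i * c = (g : Matrix (Fin N) (Fin N) F) iD i * c - (if iD = i then c else 0) := by
        simp only [hD]
        split_ifs <;> ring
      rw [hDc, AddChar.map_sub_eq_div, ← h3, div_self']
    -- Step 2: valuation bounds for the row `d` of `g`
    have hbound : ∀ i : Fin N, (i : ℕ) ≤ d → 𝓋 (D i) * 𝓋 (t i : F) ≤ exp (-M) * 𝓋 (t iD : F) := by
      intro i hi
      have hA := valuation_mul_le_of_forall_addChar_eq_one ψ hψ (ht0 i) (ht0 jD) (hcons i hi)
      refine hA.trans ?_
      have hg' := hgap iD jD hij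
      calc exp (-c₀) * 𝓋 (t jD : F) = exp (-M) * (exp (M - c₀) * 𝓋 (t jD : F)) := by
            rw [← mul_assoc, ← exp_add]
            congr 2
            ring
        _ ≤ exp (-M) * 𝓋 (t iD : F) := mul_le_mul_right hg' _
    have hDint : ∀ m : Fin N, 𝓋 (D m) ≤ exp (-M) := by
      intro m
      by_cases hm : (m : ℕ) ≤ d
      · have hle : m ≤ iD := Fin.le_def.2 hm
        have h : 𝓋 (D m) * 𝓋 (t m : F) ≤ exp (-M) * 𝓋 (t m : F) :=
          (hbound m hm).trans (mul_le_mul_right (hmono m iD hle) _)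
        exact le_of_mul_le_mul_right h (zero_lt_iff.mpr (ht0 m))
      · rw [hD0 m hm, Valuation.map_zero]
        exact zero_le
    have hDint1 : ∀ m : Fin N, 𝓋 (D m) ≤ 1 := fun m => (hDint m).trans hexpM
    have hvdd : 𝓋 (1 + D iD) = 1 := Valuation.map_one_add_of_lt _ ((hDint iD).trans_lt hexpM1)
    have hk1 : 1 + D iD ≠ 0 := fun h => by rw [h, Valuation.map_zero] at hvdd; exact zero_ne_one hvdd
    -- Step 3: the row matrix `k = 1 + e_d ⊗ D`; its row `d` is the row `d` of `g`
    set k : GL (Fin N) F := rowGL D iD hk1 with hk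
    have hkapply := rowGL_apply D iD hk1
    have hklevel : ∀ l m : Fin N,
        𝓋 ((((k : GL (Fin N) F) : Matrix (Fin N) (Fin N) F) - 1) l m * t m) ≤ exp (-M) * 𝓋 (t l : F) := by
      intro l m
      rw [Matrix.sub_apply, hkapply, Matrix.one_apply, add_sub_cancel_left]
      by_cases hl : l = iD
      · rw [if_pos hl, hl]
        by_cases hm : (m : ℕ) ≤ d
        · rw [Valuation.map_mul]
          exact hbound m hm
        · rw [hD0 m hm, zero_mul, Valuation.map_zero]
          exact zero_le
      · rw [if_neg hl, zero_mul, Valuation.map_zero]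
        exact zero_le
    have hklevel' : ∀ l m : Fin N,
        𝓋 ((((k⁻¹ : GL (Fin N) F) : Matrix (Fin N) (Fin N) F) - 1) l m * t m) ≤ exp (-M) * 𝓋 (t l : F) := by
      intro l m
      rw [Matrix.sub_apply, hk, rowGL_inv_apply, Matrix.one_apply, add_sub_cancel_left]
      by_cases hl : l = iD
      · rw [if_pos hl, hl, Valuation.map_mul, Valuation.map_mul, Valuation.map_neg, map_inv₀, hvdd,
          inv_one, one_mul, ← Valuation.map_mul]
        by_cases hm : (m : ℕ) ≤ d
        · rw [Valuation.map_mul]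
          exact hbound m hm
        · rw [hD0 m hm, zero_mul, Valuation.map_zero]
          exact zero_le
      · rw [if_neg hl, zero_mul, Valuation.map_zero]
        exact zero_le
    have hkΛ : (glDiagonal N F t)⁻¹ * k * glDiagonal N F t ∈ valuedCongruenceSubgroup (Fin N) (exp (-M)) :=
      conj_mem_valuedCongruenceSubgroup_of_level (by omega) hklevel hklevel'
    have hkK : k ∈ valuedCongruenceSubgroup (Fin N) (1 : ℤᵐ⁰) := by
      refine ⟨fun l m => ?_, fun l m => ?_, fun l m => ?_⟩
      · rw [hkapply]
        refine Valuation.map_add_le _ ?_ ?_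
        · split_ifs <;> simp
        · split_ifs
          · exact hDint1 m
          · simp
      · rw [hk, rowGL_inv_apply]
        refine Valuation.map_add_le _ ?_ ?_
        · split_ifs <;> simp
        · split_ifs
          · rw [Valuation.map_mul, Valuation.map_neg, map_inv₀, hvdd, inv_one, one_mul]
            exact hDint1 m
          · simp
      · rw [Matrix.sub_apply, hkapply, Matrix.one_apply, add_sub_cancel_left]
        split_ifs
        · exact hDint1 m
        · simp
    have hkcorner : k ∈ cornerGL N F (d + 1) := by
      intro l m hlm
      rw [hkapply]
      rcases hlm with hl | hm
      · have hliD : l ≠ iD := by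
          intro h
          rw [h] at hl
          change d + 1 ≤ d at hl
          omega
        rw [if_neg hliD, add_zero]
      · by_cases hl : l = iD
        · rw [if_pos hl, hD0 m (by omega), add_zero]
        · rw [if_neg hl, add_zero]
    -- `p = g k⁻¹` lies in the corner, has unit row `d`, and `W p ≠ 0`
    have hp : g * k⁻¹ ∈ cornerGL N F (d + 1) := mul_mem hg (inv_mem hkcorner)
    have hprow : ∀ m : Fin N, ((g * k⁻¹ : GL (Fin N) F) : Matrix (Fin N) (Fin N) F) iD m =
        if iD = m then 1 else 0 := by
      intro m
      have hrowk : ∀ x : Fin N, (g : Matrix (Fin N) (Fin N) F) iD x =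
          ((k : GL (Fin N) F) : Matrix (Fin N) (Fin N) F) iD x := by
        intro x
        rw [hkapply, if_pos rfl]
        simp only [hD]
        ring
      rw [Units.val_mul, Matrix.mul_apply]
      simp_rw [hrowk]
      rw [← Matrix.mul_apply, ← Units.val_mul, mul_inv_cancel, Units.val_one, Matrix.one_apply]
    have hWp : W (g * k⁻¹) ≠ 0 := by
      have h := hW.level k hklevel hklevel' (g * k⁻¹)
      rw [inv_mul_cancel_right] at h
      rwa [h] at hne
    -- Step 4: split off the corner `GL_d` and apply the induction hypothesis
    obtain ⟨b, hb, c, hc, hpc⟩ := exists_colGL_mul_of_row_eq iD rfl hp hprow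
    have hWc : W c ≠ 0 := by
      have h := hW.left (colGL b iD (hb _ le_rfl)) (colGL_mem_upperUnitriangular b iD hb) c
      rw [← hpc] at h
      intro h0
      rw [h0, mul_zero] at h
      exact hWp h
    obtain ⟨u', hu', k', hk', hk'Λ, hck⟩ := ih (by omega) hc hWc
    refine ⟨colGL b iD (hb _ le_rfl) * u', mul_mem (colGL_mem_upperUnitriangular b iD hb) hu',
      k' * k, mul_mem hk' hkK, ?_, ?_⟩
    · rw [show (glDiagonal N F t)⁻¹ * (k' * k) * glDiagonal N F t = (glDiagonal N F t)⁻¹ * k' *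
        glDiagonal N F t * ((glDiagonal N F t)⁻¹ * k * glDiagonal N F t) by group]
      exact mul_mem hk'Λ hkΛ
    calc g = g * k⁻¹ * k := by rw [inv_mul_cancel_right]
      _ = colGL b iD (hb _ le_rfl) * c * k := by rw [hpc]
      _ = colGL b iD (hb _ le_rfl) * u' * (k' * k) := by rw [hck]; simp only [mul_assoc]

/-- **The value on `N · Λ`**: if `W` is a spread Whittaker function (`IsSpreadWhittaker ψ t M W`),
`u ∈ N_N(F)` and `diag(t)⁻¹ k diag(t) ∈ K(𝔭^M)`, then `W(u k) = ψ_N(u) W(1)` (left equivariance and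
right `Λ`-invariance). [folklore] -/
theorem apply_mul_eq_whittakerCharFun_mul_apply_one {ψ : AddChar F Circle} {t : Fin N → Fˣ} {M : ℤ}
    {W : GL (Fin N) F → ℂ} (hW : IsSpreadWhittaker ψ t M W) {u : GL (Fin N) F}
    (hu : u ∈ upperUnitriangular (Fin N) F) {k : GL (Fin N) F}
    (hk : (glDiagonal N F t)⁻¹ * k * glDiagonal N F t ∈ valuedCongruenceSubgroup (Fin N) (exp (-M))) :
    W (u * k) = whittakerCharFun ψ ⟨u, hu⟩ * W 1 := by
  obtain ⟨hκ, hκ'⟩ := level_of_conj_mem_valuedCongruenceSubgroup hk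
  have h := hW.level k hκ hκ' 1
  rw [one_mul] at h
  rw [hW.left u hu k, h]

/-- **The value of a spread Whittaker function on a corner** (main). Same hypotheses as
`exists_unipotent_mul_level_of_ne_zero`: if `g ∈ GL_d ≤ GL_N`, `d < N`, `W(g) ≠ 0`, then `g = u k`
with `u ∈ N_N(F)`, `k ∈ GL_N(𝒪) ∩ diag(t) K(𝔭^M) diag(t)⁻¹` — the level membership spelled as the
two inequality families `|(k - 1)_{ij} t_j| ≤ exp(-M)|t_i|`, `|(k⁻¹ - 1)_{ij} t_j| ≤ exp(-M)|t_i|` of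
`IsSpreadWhittaker.level` — and `W(g) = ψ_N(u) W(1)`: on the corner `W` is `ψ_N ⊗ 𝟙` on
`N_N(F) · (Λ ∩ GL_N(𝒪))` and vanishes elsewhere (Jacquet–Piatetski-Shapiro–Shalika (1983), (2.7),
p. 393: the local integral "can be made constant"). [folklore] -/
theorem apply_eq_whittakerCharFun_mul_apply_one_of_mem_cornerGL :
    ∀ (ψ : AddChar F Circle) {c₀ M : ℤ}, (∃ x : F, Valued.v x ≤ exp (1 - c₀) ∧ ψ x ≠ 1) → 1 ≤ M →
      ∀ {t : Fin N → Fˣ}, (∀ i j : Fin N, i ≤ j → Valued.v (t j : F) ≤ Valued.v (t i : F)) →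
      (∀ i j : Fin N, (i : ℕ) + 1 = j → exp (M - c₀) * Valued.v (t j : F) ≤ Valued.v (t i : F)) →
      ∀ {W : GL (Fin N) F → ℂ}, IsSpreadWhittaker ψ t M W →
      ∀ {d : ℕ}, d < N → ∀ {g : GL (Fin N) F}, g ∈ cornerGL N F d → W g ≠ 0 →
        ∃ (u : GL (Fin N) F) (hu : u ∈ upperUnitriangular (Fin N) F) (k : GL (Fin N) F),
          k ∈ valuedCongruenceSubgroup (Fin N) (1 : ℤᵐ⁰) ∧
          (∀ i j, Valued.v (((k : Matrix (Fin N) (Fin N) F) - 1) i j * t j) ≤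
            exp (-M) * Valued.v (t i : F)) ∧
          (∀ i j, Valued.v ((((k⁻¹ : GL (Fin N) F) : Matrix (Fin N) (Fin N) F) - 1) i j * t j) ≤
            exp (-M) * Valued.v (t i : F)) ∧
          g = u * k ∧ W g = whittakerCharFun ψ ⟨u, hu⟩ * W 1 := by
  intro ψ c₀ M hψ hM₁ t hmono hgap W hW d hd g hg hne
  obtain ⟨u, hu, k, hkK, hkΛ, hgk⟩ := exists_unipotent_mul_level_of_ne_zero ψ hψ hM₁ hmono hgap hW hd hg hne
  obtain ⟨hκ, hκ'⟩ := level_of_conj_mem_valuedCongruenceSubgroup hkΛ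
  refine ⟨u, hu, k, hkK, hκ, hκ', hgk, ?_⟩
  rw [hgk]
  exact apply_mul_eq_whittakerCharFun_mul_apply_one hW hu hkΛ

end Summit.Langlands.Langlands.Theorems.WhittakerSupportValue
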